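import Literature.MathematicalPhysics.QuantumFieldTheory.Balaban1983to89.HiggsFluctMeasureWickSum
import Literature.MathematicalPhysics.QuantumFieldTheory.Balaban1983to89.B3FluctFieldWick

/-!
# `Balaban1983to89.B3FluctFieldWickSum` — T. Bałaban, *(Higgs)₂,₃ quantum fields in a finite volume. III. Renormalization*,
Commun. Math. Phys. **88** (1983) 411–445 [Balaban1983Higgs3], p. 414: **«All the A′-legs are contracted, i.e. they are
divided into pairs and each pair is replaced by the corresponding propagator» IN CLOSED FORM FOR THE FIELD
`A′ = Σ_{j<k} A′^{(j),η}` OF (1.4) WITH THE PROPAGATOR `G_k`**: `∫ Π_{i∈s}⟨A′,f_i⟩ Π_j dμ_{C^{(j),L^jη}} =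
Σ_{pairings π of s} Π_{{a,b}∈π} ⟨f_b, G_k f_a⟩` (the typer's canonical pairing sum `HiggsFluctMeasureWickSum.wickSum`),
PROVED by strong induction from the recursion `B3FluctFieldWick.wick_recursion_fluctSum`; theorems only

statement-level skeleton of published theorems with citation tags; proofs where landed; nothing here is a claim about the Yang–Mills mass gap

PDF held: `paper:balaban1983-higgs-2-3-quantum-fields-finite-volume` (journal page = PDF page + 410).

CITATION HEADER (lean-in-tree rule).  lit-balaban typed skeleton (HOME `run/shared/lean/pub/lit-balaban/`), typer line,
sequel of `B3FluctFieldWick` (recursion for `A′`, `G_k`) and `HiggsFluctMeasureWickSum` (`wickSum`, the closed form for one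
fluctuation field); located member of the SKELETON rows **B3.Eq1.12-1.15** and **B3.Eq1.4** (owner r15; cells only, zero
head weight).  THE SOURCE TEXT, p. 414 [PDF 4], verbatim: *"The formulas (1.1) and (1.2) and the basic composition formula
(I.2.43) imply that the field A′ has the covariance G_k. […] All the A′-legs are contracted, i.e. they are divided into
pairs and each pair is replaced by the corresponding propagator."*

WHAT IS PROVED (0 sorry; theorems only).  **`integral_prodPairs_eq_wickSum`**: for `msq > 0`, `a > 0`, `L > 1`, `1 ≤ k ≤ K`,
legs `f : ι → bond functions on T_η` (`ι` linearly ordered) and a finite set `s` of legs,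
`∫ Π_{i∈s}⟨A′,f_i⟩ Π_j dμ_{C^{(j),L^jη}}(A′_j) = wickSum (fun a b => ⟨f_b, G_k f_a⟩) s` — every pairing contributes the
product of the propagators `G_k` of its pairs; `integral_four_pairs_eq_wickSum` (consistency with `wickSum_four`).
HONEST SCOPE as in the two inputs.  Unit `lit-balaban-typer` gen 30 (literature-prover-lit-balaban-typer-g30-0); HOME/FILED.md
records the proposal.
-/

open scoped BigOperators
open _root_.MeasureTheory

namespace Literature.MathematicalPhysics.QuantumFieldTheory.Balaban1983to89.B3FluctFieldWickSum

open Literature.MathematicalPhysics.QuantumFieldTheory.Balaban1983to89.HiggsLattice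
open Literature.MathematicalPhysics.QuantumFieldTheory.Balaban1983to89.B3MultiscaleFields
open Literature.MathematicalPhysics.QuantumFieldTheory.Balaban1983to89.HiggsFluctMeasure
open Literature.MathematicalPhysics.QuantumFieldTheory.Balaban1983to89.HiggsFluctMeasurePos
open Literature.MathematicalPhysics.QuantumFieldTheory.Balaban1983to89.HiggsFluctMeasureWickSum
open Literature.MathematicalPhysics.QuantumFieldTheory.Balaban1983to89.B3FluctFieldWick

variable {P : HiggsLattice.Params} {msq a : ℝ} {ι : Type*} [LinearOrder ι]

/-- **WICK'S THEOREM FOR THE FIELD `A′` OF (1.4) IN CLOSED FORM** — print's *"All the A′-legs are contracted, i.e. they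
are divided into pairs and each pair is replaced by the corresponding propagator"* with the propagator `G_k` of `A′`
(*"the field A′ has the covariance G_k"*): `∫ Π_{i∈s}⟨A′,f_i⟩ Π_j dμ_{C^{(j),L^jη}} = wickSum (fun a b => ⟨f_b, G_k f_a⟩) s`
(the sum over the pairings of `s` of the products of the propagators of the pairs); `msq > 0`, `a > 0`, `L > 1`,
`1 ≤ k ≤ K`. PROVED (strong induction on `|s|` from `B3FluctFieldWick.wick_recursion_fluctSum`).
[cite: Balaban1983Higgs3, (1.4) p.414] -/
theorem integral_prodPairs_eq_wickSum (hmsq : 0 < msq) (ha : 0 < a) (hL : 1 < (P.L : ℝ)) {k : ℕ} (hk1 : 1 ≤ k)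
    (hk : k ≤ P.K) (f : ι → HiggsLattice.VecField P 0) (s : Finset ι) :
    ∫ F, ∏ i ∈ s, siteInner (toSite (∑ j : Fin k, fluctPiece msq a j (F j))) (toSite (f i)) ∂(fluctFamily P msq a k)
      = wickSum (fun a' b' => siteInner (toSite (f b')) (vecG P msq a k (toSite (f a')))) s := by
  induction s using Finset.strongInduction with
  | H s ih =>
    by_cases h : s.Nonempty
    · have hm := Finset.min'_mem s h
      have hsplit : (fun F : (j : Fin k) → HiggsLattice.VecField P j =>
            ∏ i ∈ s, siteInner (toSite (∑ j : Fin k, fluctPiece msq a j (F j))) (toSite (f i)))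
          = fun F => siteInner (toSite (∑ j : Fin k, fluctPiece msq a j (F j))) (toSite (f (s.min' h)))
              * ∏ i ∈ s.erase (s.min' h), siteInner (toSite (∑ j : Fin k, fluctPiece msq a j (F j))) (toSite (f i)) := by
        funext F
        exact (Finset.mul_prod_erase s
          (fun i => siteInner (toSite (∑ j : Fin k, fluctPiece msq a j (F j))) (toSite (f i))) hm).symm
      rw [hsplit, wick_recursion_fluctSum hmsq ha hL hk1 hk (s.erase (s.min' h)) (f (s.min' h)) f,
        wickSum_of_nonempty _ h]
      refine Finset.sum_congr rfl fun i hi => ?_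
      rw [ih _ (lt_of_le_of_lt (Finset.erase_subset _ _) (Finset.erase_ssubset hm))]
    · rw [Finset.not_nonempty_iff_eq_empty.1 h, wickSum_empty]
      haveI := fluctFamily_isProbability (P := P) hmsq ha hL hk
      simp

/-- **Four legs of `A′`, both ways**: the Isserlis formula `B3FluctFieldWick.integral_four_pairs` is the closed form on four
legs (`wickSum_four`): for `g₀ < g₁ < g₂ < g₃`, `∫ Π_{i<4}⟨A′,f_{g_i}⟩ Π_j dμ = G(0,1)G(2,3) + G(0,2)G(1,3) + G(0,3)G(1,2)`,
`G(a,b) = ⟨f_{g_b}, G_k f_{g_a}⟩`. [cite: Balaban1983Higgs3, (1.4) p.414] -/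
theorem integral_four_pairs_eq_wickSum (hmsq : 0 < msq) (ha : 0 < a) (hL : 1 < (P.L : ℝ)) {k : ℕ} (hk1 : 1 ≤ k)
    (hk : k ≤ P.K) (f : ι → HiggsLattice.VecField P 0) {g₀ g₁ g₂ g₃ : ι} (h01 : g₀ < g₁) (h12 : g₁ < g₂) (h23 : g₂ < g₃) :
    ∫ F, ∏ i ∈ ({g₀, g₁, g₂, g₃} : Finset ι), siteInner (toSite (∑ j : Fin k, fluctPiece msq a j (F j))) (toSite (f i))
        ∂(fluctFamily P msq a k)
      = siteInner (toSite (f g₁)) (vecG P msq a k (toSite (f g₀))) * siteInner (toSite (f g₃)) (vecG P msq a k (toSite (f g₂)))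
        + siteInner (toSite (f g₂)) (vecG P msq a k (toSite (f g₀))) * siteInner (toSite (f g₃)) (vecG P msq a k (toSite (f g₁)))
        + siteInner (toSite (f g₃)) (vecG P msq a k (toSite (f g₀))) * siteInner (toSite (f g₂)) (vecG P msq a k (toSite (f g₁))) := by
  rw [integral_prodPairs_eq_wickSum hmsq ha hL hk1 hk f, wickSum_four _ h01 h12 h23]

end Literature.MathematicalPhysics.QuantumFieldTheory.Balaban1983to89.B3FluctFieldWickSum
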